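import Summits.BirchSwinnertonDyer.Rank1Residual.Additive.XGssRankZeroCyclotomicThreeFacts
import Summits.BirchSwinnertonDyer.Rank1Residual.Additive.XGssRankZeroCyclotomicThreeNoLocal
import HarnessLib

/-!
# Line V18 at Facts level (X4 at `p = 3` over `K = ℚ(ζ₃)`, ranks `(0,0)`, good SUPERSINGULAR twist: Kobayashi + Kitajima–Otsuki from named facts) — Milne's A73 PROVED AWAY
# (cell `b2b-bsdres`, team n1011, seat p16 GEN 11; lead R5-87 (e) (W2) = additive-p4 GEN 23 word: the
# UPPER / two-sided no-Milne twins of the additive-p4 ℚ(ζ₃) lines are the p16 lineage's; row T-MIL-CAN)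

HONEST FRAMING (cell `b2b-bsdres`, run/shared/lean/b2b/bsd-rank1-residual/, verbatim in every
file): the goal of the cell is to DELETE the COMBINATION-SHAPED residual classes of the
Birch–Swinnerton-Dyer formula for ALL analytic-rank `≤ 1` elliptic curves over `ℚ` — "full BSD
formula for every rank `≤ 1` curve in class `C`" assembled STRICTLY from published theorems — so
that the rank-`≤ 1` remainder becomes exactly the CONSTRUCTION-SHAPED classes, which are TYPED
(missing-input `Prop`s), NOT attempted. This is not "finishing BSD". Team n1011 (N10 / N11), seat p16:
research route; X1 / X3 / X4 / X10 / N10 / N11 labels and marks UNCHANGED; nothing booked. Theorems only.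

This file is `XGssRankZeroCyclotomicThreeFacts.lean` (mathematics, census and references in THAT file's docstrings,
unchanged) with the Milne binder `hMilne : Milne1972.bsdQuotient_baseChange_quadratic_anyModel` (A73)
DELETED from every Milne-binding theorem and NOTHING added: each such theorem is re-issued under its name
with the suffix `_noMilne`, every other binder and every proof line byte-identical, every call to a
Milne-binding tree theorem redirected to its no-Milne twin (`…_noLocal` cores / `…_noMilne` Facts of the
p16 lineage); Milne-free helpers of the source file are used as landed, not re-declared. What the
additive-p4 cores read from A73 — `Ш(V_K)` finite and the `3`-adic valuation of the card identity over
`K = ℚ(ζ₃)` — are the THEOREMS `shaFinite_baseChange_of_twist` and T-MIL-CAN FILE 4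
`padicVal_card_identity_baseChange[_anyRank]_of_natAbs_discr_eq` (`|d_K| = 3`, `V` good or multiplicative
at `3`: the per-place fibre identities (T) at EVERY place — n1011-p01's T-MIL-3 H-5a with rows T-MIL-B2 /
T-A233 inside). Every other displayed hypothesis (named facts, (⊇/K) where present, census bits,
certificates) is exactly the source file's. Labels UNCHANGED; nothing booked; no mark moves.
-/

noncomputable section

open scoped Classical MatrixGroups ModularForm

open CongruenceSubgroup WeierstrassCurve NumberField
  Literature.NumberTheory.EllipticCurves Literature.NumberTheory.EllipticCurves.ModularForms
  Literature.NumberTheory.EllipticCurves.Rank1Residual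
  Literature.NumberTheory.EllipticCurves.Rank1Residual.Typed
  Literature.NumberTheory.EllipticCurves.Kobayashi2003
  Literature.NumberTheory.GaloisRepresentations

namespace Summit.BirchSwinnertonDyer.Rank1Residual.Additive

section Facts

variable (V : WeierstrassCurve ℚ) [V.IsElliptic] [V.IsGloballyMinimal]
  (W : WeierstrassCurve ℚ) [W.IsElliptic] [W.IsGloballyMinimal]

/-- **Line V18, core inequality, from named facts only** (`K = ℚ(ζ₃)` instantiated as
`CyclotomicField 3 ℚ`): for `V/ℚ` globally minimal, good at `3` with `a₃(V) = 0`, `ρ̄_{V,3ⁿ}` onto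
for every `n` and a (ram) prime for `V`, `W = C • V^{(−3)}` globally minimal ADDITIVE at `3`, both of
analytic rank `0`: `#Ш_an(V) = q_V`, `#Ш_an(W) = q_W` with
**`ord₃ #Ш(V) + ord₃ #Ш(W) + 2 ord₃ #V(K) ≤ ord₃ q_V + ord₃ q_W + ord₃ ∏_w c_w(V_K)`**, from
Kobayashi Thm. 4.1/2.2/3.2 (`hKob`, named fact), Kitajima–Otsuki Main Thm. 1.3 (`hKO`, named fact),
Pollack's existence of `L₃⁺(V,X)` (`hPol`, named fact), modularity (`hmod`,
`hmodD`), GZK (`hGZK`); the cyclotomic setting and `V(K_∞)[3^∞] = 0` (from `Irr ∧ Ram`) are theorems.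
[cite: Kobayashi2003, Thm. 4.1 (p. 8)] [cite: KitajimaOtsuki2018, Main Thm. 1.3]
[cite: Milne1972ArithmeticAV, §1 Thm. 1 and §2 (through DokchitserDokchitserAnnals2010, §2.1, proof of Thm. 8)] -/
theorem XGssCyclotomicThree.exists_padicVal_shaOrder_add_le_of_facts_noMilne
    (hKob : Kobayashi2003.thm41_plusCharIdeal_dvd_cyclotomicThree)
    (hKO : KitajimaOtsuki2018.mainThm13_plusSelmerDual_noFiniteSubmodule)
    (hPol : ∀ {N : ℕ} [NeZero N] (f : CuspForm (Gamma0 N) 2),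
      pollack_exists_plusMinusPAdicLFunction (W := V) (f := f) (p := 3))
    (hGZK : rank_eq_analyticRank_of_analyticRank_le_one) (hmod : hasEntireLFunction_rat)
    (hmodD : nonempty_modularParametrizationData)
    (C : VariableChange ℚ) (hC : C • V.quadraticTwist (-(3 : ℚ)) = W)
    (hgood : V.HasGoodReductionAtPrime 3) (ha3 : V.frobeniusTrace 3 = 0)
    (hsurj : ∀ n : ℕ, V.HasSurjectiveModNGaloisRep (3 ^ n : ℕ)) (hirr : Irr V 3) (hram : Ram V 3)
    (hadd : Addv W 3) (hrV : V.analyticRank = 0) (hrW : W.analyticRank = 0) :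
    ∃ qV qW : ℚ, shaAn V = (qV : ℂ) ∧ shaAn W = (qW : ℂ) ∧
      (padicValNat 3 V.shaOrder : ℤ) + padicValNat 3 W.shaOrder +
          2 * padicValNat 3 (Nat.card (V.baseChange (CyclotomicField 3 ℚ)).toAffine.Point) ≤
        padicValRat 3 qV + padicValRat 3 qW +
          padicValNat 3 (V.baseChange (CyclotomicField 3 ℚ)).tamagawaProduct := by
  haveI : IsCyclotomicExtension {3} ℚ (CyclotomicField 3 ℚ) := CyclotomicField.isCyclotomicExtension 3 ℚ
  have h2 : Module.finrank ℚ (CyclotomicField 3 ℚ) = 2 :=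
    finrank_eq_two_of_isCyclotomicExtension_three (K := CyclotomicField 3 ℚ)
  -- the newform, the two rational period ratios, Pollack's `L₃⁺(V, X)`
  haveI : NeZero (V.conductorNorm ℤ) := ⟨(V.conductorNorm_pos_holds).ne'⟩
  obtain ⟨Dm⟩ := hmodD V
  have hf : IsNewformOf V Dm.f := Dm.isNewformOf
  obtain ⟨ϖ, -, hϖ, -⟩ := Dm.exists_rat_mul_realPeriodRat_eq_plusPeriod
  obtain ⟨ϖ', -, hϖ'⟩ := exists_rat_mul_imaginaryPeriodRat_eq_minusPeriod Dm
  obtain ⟨L, -, hL⟩ := exists_isSignedPAdicLFunction (hPol Dm.f) (by norm_num) hf hgood ha3 1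
  haveI : (V.baseChange (CyclotomicField 3 ℚ)).IsElliptic := by rw [baseChange]; infer_instance
  refine XGssRankZeroCyclotomicThree.exists_padicVal_shaOrder_add_le_noLocal (CyclotomicField 3 ℚ) V W hGZK
    hmod C hC hgood ha3 hadd hrV hrW hf ϖ ϖ' hϖ hϖ' L hL
    (exists_isCyclotomic_isTopGenerator_cyclotomicThree (CyclotomicField 3 ℚ))
    (fun κ ↦ X11b.fixedPoints_kerSubgroup_eq_bot_of_irr_of_ram V 3 (by norm_num) hirr hram
      (CyclotomicField 3 ℚ) h2 κ)
    (fun κ γ hκ hγ hγ' D ↦ ?_) (fun κ γ hκ hγ D _ hX N' hN' ↦ ?_)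
  · obtain ⟨hfin, hX, Lω, hLω, -, hsurj'⟩ := hKob V (CyclotomicField 3 ℚ)
      (V.baseChange (CyclotomicField 3 ℚ)) hgood ha3 ⟨1, one_smul _ _⟩ hκ hγ hγ' hf L hL D ϖ ϖ' hϖ hϖ'
    exact ⟨hfin, hX, Lω, hLω, hsurj' hsurj⟩
  · exact hKO V 3 (by norm_num) hgood ha3 (CyclotomicField 3 ℚ) (V.baseChange (CyclotomicField 3 ℚ))
      ⟨1, one_smul _ _⟩ κ γ hκ hγ D hX N' hN'

/-- **Line V18 with the image hypotheses as CENSUS BITS of `W`**: `surj(3)` and `ram(3)` of the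
additive curve `W` give, for the twist `V = W^{(−3)}`, `ρ̄_{V,3ⁿ}` onto for all `n`
(`forall_surj_pow_of_twist_pStar_of_surj_of_ram`), `Irr V 3` (`surj_iff_of_model_twist`,
`irr_of_surj`) and `Ram V 3` (`ram_of_twist_pStar`); hence the core inequality on X4 ∧ (G, `e = 2`) ∧
`p = 3` ∧ `V` good supersingular, `a₃(V) = 0` ∧ ranks `(0,0)` ∧ `surj(3) ∧ ram(3)`, from named facts.
[cite: Kobayashi2003, Thm. 4.1 (p. 8)] [cite: KitajimaOtsuki2018, Main Thm. 1.3] -/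
theorem XGssCyclotomicThree.exists_padicVal_shaOrder_add_le_of_facts_of_surj_of_ram_noMilne
    (hKob : Kobayashi2003.thm41_plusCharIdeal_dvd_cyclotomicThree)
    (hKO : KitajimaOtsuki2018.mainThm13_plusSelmerDual_noFiniteSubmodule)
    (hPol : ∀ {N : ℕ} [NeZero N] (f : CuspForm (Gamma0 N) 2),
      pollack_exists_plusMinusPAdicLFunction (W := V) (f := f) (p := 3))
    (hGZK : rank_eq_analyticRank_of_analyticRank_le_one) (hmod : hasEntireLFunction_rat)
    (hmodD : nonempty_modularParametrizationData)
    (C : VariableChange ℚ) (hC : C • V.quadraticTwist (-(3 : ℚ)) = W)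
    (hgood : V.HasGoodReductionAtPrime 3) (ha3 : V.frobeniusTrace 3 = 0)
    (hsurj : Surj W 3) (hram : Ram W 3)
    (hadd : Addv W 3) (hrV : V.analyticRank = 0) (hrW : W.analyticRank = 0) :
    ∃ qV qW : ℚ, shaAn V = (qV : ℂ) ∧ shaAn W = (qW : ℂ) ∧
      (padicValNat 3 V.shaOrder : ℤ) + padicValNat 3 W.shaOrder +
          2 * padicValNat 3 (Nat.card (V.baseChange (CyclotomicField 3 ℚ)).toAffine.Point) ≤
        padicValRat 3 qV + padicValRat 3 qW +
          padicValNat 3 (V.baseChange (CyclotomicField 3 ℚ)).tamagawaProduct := by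
  have hC' : C • V.quadraticTwist (((-((3 : ℕ) : ℤ)) : ℤ) : ℚ) = W := by push_cast; exact hC
  have hsurjV : Surj V 3 :=
    (surj_iff_of_model_twist V 3 (d := -(3 : ℚ)) (by norm_num) ⟨C, hC⟩).mp hsurj
  exact XGssCyclotomicThree.exists_padicVal_shaOrder_add_le_of_facts_noMilne V W hKob hKO hPol hGZK
    hmod hmodD C hC hgood ha3
    (forall_surj_pow_of_twist_pStar_of_surj_of_ram 3 V (k := -1) (by norm_num) (Or.inr rfl) C hC'
      hsurj hram)
    (irr_of_surj V 3 hsurjV) (ram_of_twist_pStar 3 V (k := -1) (by norm_num) (Or.inr rfl) C hC' hram)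
    hadd hrV hrW

/-- **The cell's typed UPPER half for the additive X4 curve, from named facts only**: in the
situation of `XGssCyclotomicThree.exists_padicVal_shaOrder_add_le_of_facts_of_surj_of_ram_noMilne`, if
`3 ∤ #Ш_an(V)` (a bit of the TWIST pair) and `3 ∤ ∏_w c_w(V_K)` (the Tamagawa product of `V` over
`K = ℚ(ζ₃)`, the per-row datum of line V18) then `ord₃ #Ш(W) ≤ ord₃ #Ш_an(W)`, i.e.
`Typed.MissingUpperBoundAt W 3`. [cite: Kobayashi2003, Thm. 4.1 (p. 8)] [cite: KitajimaOtsuki2018, Main Thm. 1.3] -/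
theorem XGssCyclotomicThree.missingUpperBoundAt_of_surj_of_ram_noMilne
    (hKob : Kobayashi2003.thm41_plusCharIdeal_dvd_cyclotomicThree)
    (hKO : KitajimaOtsuki2018.mainThm13_plusSelmerDual_noFiniteSubmodule)
    (hPol : ∀ {N : ℕ} [NeZero N] (f : CuspForm (Gamma0 N) 2),
      pollack_exists_plusMinusPAdicLFunction (W := V) (f := f) (p := 3))
    (hGZK : rank_eq_analyticRank_of_analyticRank_le_one) (hmod : hasEntireLFunction_rat)
    (hmodD : nonempty_modularParametrizationData)
    (C : VariableChange ℚ) (hC : C • V.quadraticTwist (-(3 : ℚ)) = W)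
    (hgood : V.HasGoodReductionAtPrime 3) (ha3 : V.frobeniusTrace 3 = 0)
    (hsurj : Surj W 3) (hram : Ram W 3)
    (hadd : Addv W 3) (hrV : V.analyticRank = 0) (hrW : W.analyticRank = 0)
    {qV : ℚ} (hqV : shaAn V = (qV : ℂ)) (hv : padicValRat 3 qV ≤ 0)
    (htam : padicValNat 3 (V.baseChange (CyclotomicField 3 ℚ)).tamagawaProduct = 0) :
    MissingUpperBoundAt W 3 := by
  obtain ⟨qV', qW, hqV', hqW, hle⟩ :=
    XGssCyclotomicThree.exists_padicVal_shaOrder_add_le_of_facts_of_surj_of_ram_noMilne V W hKob hKO hPol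
      hGZK hmod hmodD C hC hgood ha3 hsurj hram hadd hrV hrW
  have hqq : qV' = qV := by exact_mod_cast hqV'.symm.trans hqV
  subst hqq
  refine ⟨qW, hqW, ?_⟩
  have h0 : (0 : ℤ) ≤ padicValNat 3 V.shaOrder := by positivity
  have h1 : (0 : ℤ) ≤ padicValNat 3 (Nat.card (V.baseChange (CyclotomicField 3 ℚ)).toAffine.Point) := by
    positivity
  rw [htam, Nat.cast_zero, add_zero] at hle
  linarith

/-- **`BSD(W,3) ∧ BSD(V,3)` on the unit X4 rows of line V18, from named facts only**: in the
situation of `XGssCyclotomicThree.exists_padicVal_shaOrder_add_le_of_facts_of_surj_of_ram_noMilne`, if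
`#Ш_an(V)`, `#Ш_an(W)` are `3`-adic units and `3 ∤ ∏_w c_w(V_K)` (`K = ℚ(ζ₃)`), then Miller's
`BSD(W,3)` (the ADDITIVE, potentially supersingular X4 pair: `W` of type `I₀*` at `3`, `W[3]`
irreducible) and `BSD(V,3)` (its good supersingular big-image twist, `a₃(V) = 0`) hold. Inputs:
Kobayashi 2003 Thm. 4.1/2.2/3.2, Kitajima–Otsuki 2018 Main Thm. 1.3, Pollack 2003, Milne (named
facts), modularity, GZK, and the census bits `surj(3)`, `ram(3)`, `3 ∤ #Ш_an` of the two curves and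
`3 ∤ ∏_w c_w(V_K)` — nothing typed. Label X4 UNCHANGED; nothing booked by this theorem.
[cite: Kobayashi2003, Thm. 4.1 (p. 8)] [cite: KitajimaOtsuki2018, Main Thm. 1.3]
[cite: Milne1972ArithmeticAV, §1 Thm. 1 and §2 (through DokchitserDokchitserAnnals2010, §2.1, proof of Thm. 8)] -/
theorem XGssCyclotomicThree.bsdp_of_shaAn_units_of_surj_of_ram_noMilne
    (hKob : Kobayashi2003.thm41_plusCharIdeal_dvd_cyclotomicThree)
    (hKO : KitajimaOtsuki2018.mainThm13_plusSelmerDual_noFiniteSubmodule)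
    (hPol : ∀ {N : ℕ} [NeZero N] (f : CuspForm (Gamma0 N) 2),
      pollack_exists_plusMinusPAdicLFunction (W := V) (f := f) (p := 3))
    (hGZK : rank_eq_analyticRank_of_analyticRank_le_one) (hmod : hasEntireLFunction_rat)
    (hmodD : nonempty_modularParametrizationData)
    (C : VariableChange ℚ) (hC : C • V.quadraticTwist (-(3 : ℚ)) = W)
    (hgood : V.HasGoodReductionAtPrime 3) (ha3 : V.frobeniusTrace 3 = 0)
    (hsurj : Surj W 3) (hram : Ram W 3)
    (hadd : Addv W 3) (hrV : V.analyticRank = 0) (hrW : W.analyticRank = 0)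
    {qV qW : ℚ} (hqV : shaAn V = (qV : ℂ)) (hqW : shaAn W = (qW : ℂ))
    (hvV : padicValRat 3 qV = 0) (hvW : padicValRat 3 qW = 0)
    (htam : padicValNat 3 (V.baseChange (CyclotomicField 3 ℚ)).tamagawaProduct = 0) :
    BSDp W 3 ∧ BSDp V 3 := by
  obtain ⟨qV', qW', hqV', hqW', hle⟩ :=
    XGssCyclotomicThree.exists_padicVal_shaOrder_add_le_of_facts_of_surj_of_ram_noMilne V W hKob hKO hPol
      hGZK hmod hmodD C hC hgood ha3 hsurj hram hadd hrV hrW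
  have hqq : qV' = qV := by exact_mod_cast hqV'.symm.trans hqV
  have hqq' : qW' = qW := by exact_mod_cast hqW'.symm.trans hqW
  subst hqq hqq'
  rw [hvV, hvW, htam, Nat.cast_zero, add_zero, add_zero] at hle
  have hV0 : (0 : ℤ) ≤ padicValNat 3 V.shaOrder := by positivity
  have hW0 : (0 : ℤ) ≤ padicValNat 3 W.shaOrder := by positivity
  have hK0 : (0 : ℤ) ≤ padicValNat 3 (Nat.card (V.baseChange (CyclotomicField 3 ℚ)).toAffine.Point) := by
    positivity
  have huW : MissingUpperBoundAt W 3 := ⟨qW', hqW', by rw [hvW]; linarith⟩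
  have huV : MissingUpperBoundAt V 3 := ⟨qV', hqV', by rw [hvV]; linarith⟩
  exact ⟨bsdp_of_missingPPartAt W 3 hGZK (by rw [hrW]; exact zero_le_one)
      (missingPPartAt_of_upper_of_shaAn_unit W 3 huW hqW' hvW),
    bsdp_of_missingPPartAt V 3 hGZK (by rw [hrV]; exact zero_le_one)
      (missingPPartAt_of_upper_of_shaAn_unit V 3 huV hqV' hvV)⟩

end Facts

end Summit.BirchSwinnertonDyer.Rank1Residual.Additive

end
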